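import Summits.ABC.StewartYu.PadicG3TwoThirdStep
import Summits.ABC.StewartYu.PadicG3TwoLevelZero
import HarnessLib

/-!
# Cell abc-stewartyu, Gen-3 frame at `p = 2` (crux `Y07Two`, stmt-ABC-19659), assembly: the PRE-SCALED FEL'DMAN
# BASIS `Δ(3^{I*−I}·Y₀; ℓ, H)` — its shape predicate, the basis step `BasisStepTwo` at every level, and level `0`

`Summits/ABC/StewartYu/PadicG3TwoBasisStep.lean` — cell `abc-stewartyu` (HOME `run/shared/lean/pub/abc-stewartyu/`),
route `PadicPrimesKummerThird`, seat p5 (g3); assembly glue on p5's `PadicG3TwoMain`/`PadicG3TwoThirdStep` and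
p3-g5's `PadicG3TwoFeldmanBasis`/`PadicG3TwoFeldmanAdm`/`PadicG3TwoLevelZero`.  Two definitions (`feldRs`, the
scaled basis; `ShFeld`, the shape predicate) and theorems on `TwoSetup`; no named fact.

NESTERENKO'S PRE-SCALING (LNM 1819 §4, `f_s(z)` built on `Δ(2^{S−s}z; ℓ₀, H)`; here `q = 3`).  The third step
replaces the `Y₀`-basis `R` by `R ∘ (Y₀/3)` (`PadicG3TwoThirdReindex`); to keep the `Y₀`-weights INTEGER-valued at
the integer nodes at EVERY level, the level-`0` basis is `Δ(3^{I*}·Y₀; ℓ, H)` and the level-`I` basis is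
`feldRs ℓ H (I* − I) = Δ(3^{I*−I}·Y₀; ℓ, H)` (`ShFeld`), whose Hasse weights at an integer `x` are
`3^{(I*−I)t}·(Hasse_t Δ)(3^{I*−I}x)` — an integer after `ν(H)^t` with Fel'dman's size at the point `3^{I*−I}x`
(`exists_int_lcm_pow_mul_hasse_feldRs`), and whose `2`-adic coefficient sizes are those of `Δ` (`3` is a `2`-adic
unit, `feldRs_wt`).  Hence:
* `basisStepTwo_feld : … → BasisStepTwo σ (ShFeld I* H L₀) I` for `I + 1 ≤ I*`, from two record lines
  (`den₀ (I+1) = ν(H)^{t}`, `M₀ (I+1) x τ ≥ 3^{et}ν(H)^t e^{H/e}(e(1+3^e|x|/H))^{L₀}`, `e = I* − (I+1)`);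
* `siegelTwo_feldman_scaled : … → SiegelTwo σ (ShFeld I* H L₀)` — p3-g5's `siegelTwo_feldman` for the scaled
  basis (same proof through `exists_g3_slab_siegel`), with the shape predicate now CONCRETE (no `hSh` hypothesis).
With `kchainTwo_of_kfinal` (p5) and `thirdStepTwo_of` (p5) this leaves, for `stub_frameTwoLast_of_mainTwo` (p3-g5),
only the record's numeric `Prop`s and `RecordTwo`.

WHAT THIS IS NOT: no numbers; no crux moves.

References: Yu. V. Nesterenko, LNM 1819 (2003), §3.1 Prop 3.1, §4 (4.20); K. Yu, Acta Math. 211 (2013), (5.5).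
-/

noncomputable section

open Finset Polynomial
open Literature.NumberTheory.Transcendental
open Literature.NumberTheory.Transcendental (FeldmanDelta.num FeldmanDelta.den)
open Literature.NumberTheory.Transcendental.FeldmanDelta
open Literature.NumberTheory.Transcendental.CW77.Setup (Tau tauNorm)

namespace Summit.ABC.StewartYu

/-! ### Linear rescaling of a polynomial basis -/

namespace FeldmanBasis

/-- `(f ∘ (a·Y)) ∘ (b·Y) = f ∘ ((a·b)·Y)`. [folklore] -/
theorem comp_C_mul_X_comp {K : Type*} [Field K] (f : K[X]) (a b : K) :
    (f.comp (C a * X)).comp (C b * X) = f.comp (C (a * b) * X) := by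
  rw [Polynomial.comp_assoc, mul_comp, C_comp, X_comp, map_mul, mul_assoc]

/-- `deg (f ∘ (c·Y)) = deg f` for `c ≠ 0`. [folklore] -/
theorem natDegree_comp_C_mul_X {K : Type*} [Field K] (f : K[X]) {c : K} (hc : c ≠ 0) :
    (f.comp (C c * X)).natDegree = f.natDegree := by
  rw [natDegree_comp, natDegree_C_mul_X _ hc, mul_one]

/-- `f ∘ (c·Y) ≠ 0` for `f ≠ 0`, `c ≠ 0`. [folklore] -/
theorem comp_C_mul_X_ne_zero {K : Type*} [Field K] {f : K[X]} (hf : f ≠ 0) {c : K} (hc : c ≠ 0) :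
    f.comp (C c * X) ≠ 0 := by
  intro h0
  have hlc := leadingCoeff_comp (p := f) (q := C c * X) (by rw [natDegree_C_mul_X _ hc]; exact one_ne_zero)
  rw [h0, leadingCoeff_zero, leadingCoeff_C_mul_X] at hlc
  exact (mul_ne_zero (leadingCoeff_ne_zero.mpr hf) (pow_ne_zero _ hc)) hlc.symm

/-- `(Hasse_t (f ∘ (c·Y)))(x) = cᵗ·(Hasse_t f)(c·x)`. [folklore] -/
theorem eval_hasseDeriv_comp_C_mul_X {K : Type*} [Field K] (f : K[X]) (c : K) (t : ℕ) (x : K) :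
    (hasseDeriv t (f.comp (C c * X))).eval x = c ^ t * (hasseDeriv t f).eval (c * x) := by
  rw [TwoSetup.hasseDeriv_comp_C_mul_X, eval_mul, eval_C, eval_comp, eval_mul, eval_C, eval_X]

/-! ### The pre-scaled Fel'dman basis `Δ(3ᵉ·Y₀; ℓ, H)` -/

/-- **The pre-scaled Fel'dman basis** `feldRs ℓ H e = Δ(3ᵉ·Y₀; ℓ, H)`. [cite: Nesterenko2003, §4 (4.20); shape only] -/
def feldRs (ℓ H e : ℕ) : ℚ[X] := (feldR ℓ H).comp (C ((3 : ℚ) ^ e) * X)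

/-- `deg Δ(3ᵉ·Y₀; ℓ, H) = ℓ`. [folklore] -/
theorem natDegree_feldRs (ℓ H e : ℕ) : (feldRs ℓ H e).natDegree = ℓ := by
  unfold feldRs
  rw [natDegree_comp_C_mul_X _ (pow_ne_zero _ (by norm_num)), natDegree_feldR_eq]

/-- `Δ(3ᵉ·Y₀; ℓ, H) ≠ 0`. [folklore] -/
theorem feldRs_ne_zero (ℓ H e : ℕ) : feldRs ℓ H e ≠ 0 :=
  comp_C_mul_X_ne_zero (feldR_ne_zero ℓ H) (pow_ne_zero _ (by norm_num))

/-- **Rescaling by `3⁻¹` lowers the exponent**: `feldRs ℓ H (e+1) ∘ (Y₀/3) = feldRs ℓ H e`. [folklore] -/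
theorem feldRs_succ_comp_third (ℓ H e : ℕ) :
    (feldRs ℓ H (e + 1)).comp (C (3⁻¹ : ℚ) * X) = feldRs ℓ H e := by
  unfold feldRs
  rw [comp_C_mul_X_comp, pow_succ, mul_assoc, mul_inv_cancel₀ (by norm_num : (3 : ℚ) ≠ 0), mul_one]

/-- **Integrality and size of the Hasse weights of the pre-scaled basis at an integer point**:
`ν(H)^t·(Hasse_t Δ(3ᵉ·Y₀; ℓ, H))(x) = 3^{et}·zeroWeight ℓ H t (3ᵉx) ∈ ℤ`, of size
`≤ 3^{et}·ν(H)^t·e^{H/e}·(e(1 + 3ᵉ|x|/H))^ℓ`. [cite: Nesterenko2003, §3.1 Prop 3.1] -/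
theorem exists_int_lcm_pow_mul_hasse_feldRs (ℓ : ℕ) {H : ℕ} (hH : 1 ≤ H) (e t : ℕ) (x : ℤ) {M₀ : ℤ}
    (hM : (3 : ℝ) ^ (e * t) * ((Nat.lcmUpto H : ℝ) ^ t *
      (Real.exp (H / Real.exp 1) * (Real.exp 1 * (1 + (3 : ℝ) ^ e * |(x : ℝ)| / H)) ^ ℓ)) ≤ M₀) :
    ∃ z₀ : ℤ, (((Nat.lcmUpto H) ^ t : ℕ) : ℚ) * (hasseDeriv t (feldRs ℓ H e)).eval (x : ℚ) = z₀ ∧ |z₀| ≤ M₀ := by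
  have hy : ((3 : ℚ) ^ e * (x : ℚ)) = ((3 ^ e * x : ℤ) : ℚ) := by push_cast; ring
  refine ⟨3 ^ (e * t) * DirWeights.zeroWeight ℓ H t (3 ^ e * x), ?_, ?_⟩
  · unfold feldRs
    rw [eval_hasseDeriv_comp_C_mul_X, ← mul_assoc, mul_comm (((Nat.lcmUpto H ^ t : ℕ) : ℚ)), mul_assoc, hy,
      lcm_pow_mul_hasse_feldR_eq_zeroWeight ℓ hH t (3 ^ e * x), ← pow_mul]
    push_cast; ring
  · have h1 := DirWeights.abs_zeroWeight_le ℓ hH t (3 ^ e * x)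
    have h3 : (0 : ℝ) ≤ (3 : ℝ) ^ (e * t) := by positivity
    have h2 : |(((3 : ℤ) ^ (e * t) * DirWeights.zeroWeight ℓ H t (3 ^ e * x) : ℤ) : ℝ)| ≤
        (3 : ℝ) ^ (e * t) * ((Nat.lcmUpto H : ℝ) ^ t *
          (Real.exp (H / Real.exp 1) * (Real.exp 1 * (1 + (3 : ℝ) ^ e * |(x : ℝ)| / H)) ^ ℓ)) := by
      push_cast
      rw [abs_mul, abs_pow, abs_of_pos (by norm_num : (0 : ℝ) < 3)]
      refine mul_le_mul_of_nonneg_left ?_ h3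
      have : |((3 ^ e * x : ℤ) : ℝ)| = (3 : ℝ) ^ e * |(x : ℝ)| := by
        push_cast; rw [abs_mul, abs_pow, abs_of_pos (by norm_num : (0 : ℝ) < 3)]
      rw [this] at h1
      exact h1
    exact_mod_cast h2.trans hM

/-- **The `2`-adic coefficient sizes of the pre-scaled basis are those of `Δ`** (`3` is a `2`-adic unit):
`‖coeffₖ(hw Δ(3ᵉ·Y₀) t)‖₂·ρᵏ ≤ ‖den(ℓ,H)⁻¹‖₂·ρ^ℓ` for `ρ ≥ 1`. [cite: Nesterenko2003, §3.1; shape only] -/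
theorem norm_coeff_hw_feldRs_mul_pow_le {ι : Type*} (ℓ₀ : ι → ℕ) (H e : ℕ) (i : ι) (t k : ℕ) {ρ : ℝ}
    (hρ1 : 1 ≤ ρ) :
    ‖(TwoSetup.hw (fun i => feldRs (ℓ₀ i) H e) i t).coeff k‖ * ρ ^ k ≤
      ‖((den (ℓ₀ i) H : ℚ_[2]))⁻¹‖ * ρ ^ (ℓ₀ i) := by
  have hcoeff : ‖(TwoSetup.hw (fun i => feldRs (ℓ₀ i) H e) i t).coeff k‖ =
      ‖(TwoSetup.hw (fun i => feldR (ℓ₀ i) H) i t).coeff k‖ := by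
    unfold TwoSetup.hw feldRs
    rw [Polynomial.coeff_map, Polynomial.coeff_map, TwoSetup.coeff_hasseDeriv_comp_C_mul_X, map_mul,
      norm_mul, map_pow, norm_pow, eq_ratCast, eq_ratCast]
    have h3 : ‖(((3 : ℚ) ^ e : ℚ) : ℚ_[2])‖ = 1 := by
      push_cast
      rw [norm_pow, TwoSetup.norm_three_two, one_pow]
    rw [h3, one_pow, one_mul]
  rw [hcoeff]
  exact norm_coeff_hw_feldR_mul_pow_le ℓ₀ H i t k hρ1

end FeldmanBasis

/-! ### The shape predicate and the basis step -/

namespace TwoSetup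

open Summit.ABC.StewartYu.FeldmanBasis Summit.ABC.StewartYu.G3Boxes

variable {S : TwoSetup} (σ : S.G3TwoSched)

/-- **The shape predicate of the pre-scaled Fel'dman assembly**: at level `I` every unknown `i` carries the
`Y₀`-factor `Δ(3^{I*−I}·Y₀; i.1, H)` with `i.1 ≤ L₀`. [cite: Nesterenko2003, §4 (4.20); shape only] -/
def ShFeld (Istar H L₀ : ℕ) (I : ℕ) (Λ : S.G3Fam (ℕ × ((Fin S.d → ℤ) × ℤ))) : Prop :=
  ∀ i ∈ Λ.B, i.1 ≤ L₀ ∧ Λ.R i = feldRs i.1 H (Istar - I)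

/-- **THE BASIS STEP for the pre-scaled Fel'dman basis** at a level `I` with `I + 1 ≤ I*`, from the two record
lines `den₀ (I+1) x τ = ν(H)^{τ.1}` and `M₀ (I+1) x τ ≥ 3^{et}·ν(H)^t·e^{H/e}·(e(1+3ᵉ|x|/H))^ℓ` for all `ℓ ≤ L₀`
(`e = I* − (I+1)`, `t = τ.1`). [cite: Nesterenko2003, §3.1 Prop 3.1 and §4 (4.20)] -/
theorem basisStepTwo_feld {H L₀ I : ℕ} (hH : 1 ≤ H) (hI : I + 1 ≤ σ.Istar)
    (hden₀ : ∀ (x : ℤ) (τ : Tau S.d), σ.den₀ (I + 1) x τ = Nat.lcmUpto H ^ τ.1)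
    (hM₀ : ∀ (x : ℤ) (τ : Tau S.d), ∀ ℓ, ℓ ≤ L₀ →
      (3 : ℝ) ^ ((σ.Istar - (I + 1)) * τ.1) * ((Nat.lcmUpto H : ℝ) ^ τ.1 *
        (Real.exp (H / Real.exp 1) *
          (Real.exp 1 * (1 + (3 : ℝ) ^ (σ.Istar - (I + 1)) * |(x : ℝ)| / H)) ^ ℓ)) ≤ σ.M₀ (I + 1) x τ) :
    BasisStepTwo σ (ShFeld σ.Istar H L₀) I := by
  have hcomp : ∀ ℓ, (feldRs ℓ H (σ.Istar - I)).comp (C (3⁻¹ : ℚ) * X) = feldRs ℓ H (σ.Istar - (I + 1)) := by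
    intro ℓ
    have e : σ.Istar - I = (σ.Istar - (I + 1)) + 1 := by omega
    rw [e, feldRs_succ_comp_third]
  refine ⟨?_, ?_⟩
  · intro Λ hadm i hi x τ
    obtain ⟨hℓ, hR⟩ := hadm.shape i hi
    rw [hR, hcomp, hden₀]
    exact exists_int_lcm_pow_mul_hasse_feldRs i.1 hH _ τ.1 x (hM₀ x τ i.1 hℓ)
  · intro Λ hadm v i₁ _ i hi
    have hiB : i ∈ Λ.B := Λ.reindex3_B_subset v i₁ hi
    obtain ⟨hℓ, hR⟩ := hadm.shape i hiB
    refine ⟨hℓ, ?_⟩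
    change (Λ.R i).comp (C (3⁻¹ : ℚ) * X) = _
    rw [hR, hcomp]

/-! ### Level `0` for the pre-scaled basis -/

/-- The admissibility fields of the pre-scaled Fel'dman family on a sub-box (`deg_ne`, `R_ne`, `deg_le`).
[cite: Nesterenko2003, §3.1; shape only] -/
theorem feldRs_degrees (H e : ℕ) {L₀ D₀ : ℕ} (hL : L₀ ≤ D₀) {Dbox : Fin S.d → ℕ} {Dθ : ℕ}
    (B : Finset (ℕ × ((Fin S.d → ℤ) × ℤ))) (hB : B ⊆ famBox L₀ Dbox Dθ) :
    (∀ i ∈ B, ∀ i' ∈ B, S.allκ (fun i => i.2.1) (fun i => i.2.2) i = S.allκ (fun i => i.2.1) (fun i => i.2.2) i' →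
        i ≠ i' → (feldRs i.1 H e).natDegree ≠ (feldRs i'.1 H e).natDegree) ∧
      (∀ i ∈ B, (fun i : ℕ × ((Fin S.d → ℤ) × ℤ) => feldRs i.1 H e) i ≠ 0) ∧
      (∀ i ∈ B, (feldRs i.1 H e).natDegree ≤ D₀) := by
  refine ⟨?_, fun i _ => feldRs_ne_zero i.1 H e, ?_⟩
  · intro i _ i' _ hκ hne hdeg
    rw [natDegree_feldRs, natDegree_feldRs] at hdeg
    rw [allκ_feldman_eq_iff] at hκ
    exact hne (Prod.ext hdeg hκ)
  · intro i hi
    rw [natDegree_feldRs]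
    exact ((mem_famBox.mp (hB hi)).1).trans hL

/-- **LEVEL `0` FOR THE PRE-SCALED FEL'DMAN BASIS** `Δ(3^{I*}·Y₀; ℓ, H)` on one slab class of the box
`famBox L₀ (Dbox 0) (Dθ 0)`: `SiegelTwo σ (ShFeld I* H L₀)` from the negated bound `‖Λ₀‖ ≤ 2^{−(m+3)}` and the
record's level-`0` scalar lines (as in p3-g5's `siegelTwo_feldman`, with the Hasse sizes taken at the points
`3^{I*}x`). [cite: Yu2013, Lemma 4.2 and (5.22)] [cite: Nesterenko2003, §3.5 Prop 3.9; shape only] -/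
theorem siegelTwo_feldman_scaled (H L₀ : ℕ) (hH : 1 ≤ H)
    (hΛ : ‖S.Λ₀‖ ≤ ((2 : ℝ) ^ (σ.m + 3))⁻¹)
    (hT0 : 1 ≤ σ.T0 0)
    (hcount : 2 * 2 ^ σ.m * ((2 * σ.N0 0 + 1) * σ.T0 0 ^ (S.d + 1)) ≤
      (L₀ + 1) * ((∏ j, (2 * σ.Dbox 0 j + 1)) * (2 * σ.Dθ 0 + 1)))
    (hcardB : (famBox L₀ (σ.Dbox 0) (σ.Dθ 0)).card ≤ σ.cardB 0)
    (hL : L₀ ≤ σ.D₀)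
    (hXb : ∀ i ∈ famBox L₀ (σ.Dbox 0) (σ.Dθ 0), ∀ j, |S.dirScalar i.2.1 i.2.2 j| ≤ σ.Xb 0)
    (hBw : ∀ ℓ, ℓ ≤ L₀ → ‖((den ℓ H : ℚ_[2]))⁻¹‖ * (4 * (2 : ℝ) ^ σ.m) ^ ℓ ≤ σ.Bw 0)
    (hden₀ : ∀ (x : ℤ) (τ : Tau S.d), σ.den₀ 0 x τ = Nat.lcmUpto H ^ τ.1)
    (hM₀ : ∀ (x : ℤ) (τ : Tau S.d), ∀ ℓ, ℓ ≤ L₀ →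
      (3 : ℝ) ^ (σ.Istar * τ.1) * ((Nat.lcmUpto H : ℝ) ^ τ.1 *
        (Real.exp (H / Real.exp 1) * (Real.exp 1 * (1 + (3 : ℝ) ^ σ.Istar * |(x : ℝ)| / H)) ^ ℓ)) ≤
        σ.M₀ 0 x τ)
    {M₀E : ℤ} (hM₀E : ∀ e ∈ eqSet S.d (σ.N0 0) (σ.T0 0), σ.M₀ 0 e.1 e.2 ≤ M₀E)
    {Amax : ℝ} (hAmax : 1 ≤ Amax)
    (hA : ∀ e ∈ eqSet S.d (σ.N0 0) (σ.T0 0), (M₀E : ℝ) * (σ.Xb 0 : ℝ) ^ (∑ j, e.2.2 j) *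
      ((MonomialDen.monDen S.toQ.all (S.boxExp (σ.Dbox 0) (σ.Dθ 0) e.1) : ℝ)) ^ 2 ≤ Amax)
    (hP : ⌈((famBox L₀ (σ.Dbox 0) (σ.Dθ 0)).card : ℝ) * Amax⌉ ≤ σ.P) :
    SiegelTwo σ (ShFeld σ.Istar H L₀) := by
  classical
  set B : Finset (ℕ × ((Fin S.d → ℤ) × ℤ)) := famBox L₀ (σ.Dbox 0) (σ.Dθ 0) with hBdef
  set E : Finset (ℤ × Tau S.d) := eqSet S.d (σ.N0 0) (σ.T0 0) with hEdef
  set R : ℕ × ((Fin S.d → ℤ) × ℤ) → ℚ[X] := fun i => feldRs i.1 H σ.Istar with hRdef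
  set u : ℕ × ((Fin S.d → ℤ) × ℤ) → Fin S.d → ℤ := fun i => i.2.1 with hudef
  set uθ : ℕ × ((Fin S.d → ℤ) × ℤ) → ℤ := fun i => i.2.2 with huθdef
  have hbox := S.feldman_box_le B (subset_refl _)
  have hlcm1 : 1 ≤ Nat.lcmUpto H := Nat.lcmUpto_pos H
  have hden₀1 : ∀ e ∈ E, 1 ≤ σ.den₀ 0 e.1 e.2 := by
    intro e _; rw [hden₀]; exact Nat.one_le_pow _ _ hlcm1
  -- pointwise Hasse data for the scaled basis, then uniformised on `E`
  have hhasse : ∀ i ∈ B, ∀ (x : ℤ) (τ : Tau S.d), ∃ z₀ : ℤ,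
      (σ.den₀ 0 x τ : ℚ) * (hasseDeriv τ.1 (R i)).eval (x : ℚ) = z₀ ∧ |z₀| ≤ σ.M₀ 0 x τ := by
    intro i hi x τ
    rw [hden₀]
    have h := exists_int_lcm_pow_mul_hasse_feldRs i.1 hH σ.Istar τ.1 x
      (hM₀ x τ i.1 (mem_famBox.mp hi).1)
    simpa only [hRdef] using h
  have hR : ∀ e ∈ E, ∀ i ∈ B, ∃ z₀ : ℤ,
      ((σ.den₀ 0 e.1 e.2 : ℕ) : ℚ) * (hasseDeriv e.2.1 (R i)).eval (e.1 : ℚ) = z₀ ∧ |z₀| ≤ M₀E := by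
    intro e he i hi
    obtain ⟨z₀, hz₀, hle⟩ := hhasse i hi e.1 e.2
    exact ⟨z₀, hz₀, hle.trans (hM₀E e he)⟩
  -- the slab Siegel lemma
  obtain ⟨𝔏, p, h𝔏B, _hcnt, _h𝔏ne, hslab, hsupp, ⟨i₀, hpi₀⟩, hpbd, hsol⟩ :=
    S.exists_g3_slab_siegel R u uθ B σ.m hΛ E (eqSet_nonempty S.d (σ.N0 0) hT0)
      (siegel_count σ.m L₀ (σ.Dbox 0) (σ.Dθ 0) (σ.N0 0) (σ.T0 0) hcount) hbox.1 hbox.2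
      (fun e => σ.den₀ 0 e.1 e.2) hden₀1 hR hXb hAmax hA
  have hi₀ : i₀ ∈ 𝔏 := hsupp i₀ hpi₀
  have h𝔏card : 𝔏.card ≤ B.card := card_le_card h𝔏B
  have hdegs := S.feldRs_degrees H σ.Istar hL 𝔏 h𝔏B
  have hρ1 : (1 : ℝ) ≤ 4 * (2 : ℝ) ^ σ.m := by
    have : (1 : ℝ) ≤ 2 ^ σ.m := one_le_pow₀ (by norm_num)
    nlinarith
  refine ⟨⟨𝔏, R, u, uθ, p, i₀⟩, ?_, ?_⟩
  · exact
      { card_le := h𝔏card.trans hcardB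
        exists_ne := ⟨i₀, hi₀, hpi₀⟩
        deg_ne := hdegs.1
        R_ne := hdegs.2.1
        deg_le := hdegs.2.2
        p_le := by
          intro i _
          refine (hpbd i).trans (le_trans ?_ hP)
          exact Int.ceil_le_ceil (mul_le_mul_of_nonneg_right (by exact_mod_cast h𝔏card)
            (le_trans zero_le_one hAmax))
        u_le := (S.feldman_box_le 𝔏 h𝔏B).1
        uθ_le := (S.feldman_box_le 𝔏 h𝔏B).2
        dir_le := fun i hi j => hXb i (h𝔏B hi) j
        slab := hslab i₀ hi₀
        wt := fun i hi t₀ k =>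
          (norm_coeff_hw_feldRs_mul_pow_le (fun i : ℕ × ((Fin S.d → ℤ) × ℤ) => i.1) H σ.Istar i t₀ k
            hρ1).trans (hBw i.1 (mem_famBox.mp (h𝔏B hi)).1)
        hasse := fun i hi x τ => hhasse i (h𝔏B hi) x τ
        shape := fun i hi => ⟨(mem_famBox.mp (h𝔏B hi)).1, by rw [Nat.sub_zero]⟩ }
  · rw [G3Fam.vanish_all_iff]
    exact vanish_of_eqSet S R u uθ 𝔏 p hsol

end TwoSetup

end Summit.ABC.StewartYu

end
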